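/-
Copyright (c) 2026 the pub-hodgecm-mathlib formalisation cell (harness21).  Prover seat hodgecm-mathlib-LD1-p02 (g2), organ payer of half-A
line LD1 (dealer LD1-plan (g0), deal (a) 2026-09-02T04:57:02Z «file the probe `probe.G1_of_curveMultiplicityLeOne` 52323b30a8f1d503 as a Theorems helper»),
2026-09-02.  THEOREMS ONLY (no definition, no named fact, no `sorry`, no instance, no notation).  `--supports stmt-HodgeConjecture-24832 --as helper`.
-/
import Summits.HodgeConjecture.HodgeConjecture.Theorems.HLiu418E1pOfE1
import Literature.NumberTheory.Rogawski1990.CurveThetaCohFinComponentUnique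
import Literature.NumberTheory.Rogawski1990.CurveCohomologicalSpectrum
import HarnessLib

/-!
# The Paydown's global stub G1 `MultLeOneAtThetaHol₂` is a ONE-LINE RESTRICTION of the typed letter `Rogawski1990.curveMultiplicityLeOne`;
# hence #73 `curveThetaCohFinComponentUnique_hol` follows from that ONE letter through the (★, sorry-free) Paydown certificate

Cell hodgecm-mathlib FLOOR 0, programme P6, half-A line LD (crux `hLiu418` = `stmt-HodgeConjecture-24832`); line LD1 (socket 27458
`Cruxes/HLiu418/Lines/F0_AlbCm.lean` :241 `stub_S1_facts : Rogawski1990.curveThetaCohFinComponentUnique_hol` = books row III-19 (#73) E1θhol₂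
[Liu2021, Prop. D.4 (1), the «`≤ 1`» half]).  Namespace `Summit.HodgeConjecture.HodgeConjecture.Cruxes.HLiu418.F0LD1MultLeOneAtThetaHolOfLetter`.
Source: LD1-plan (g0)'s farm-green probe `F0/P6/LD/LD1-plan/g0/probe.G1_of_curveMultiplicityLeOne.v1.LD1-plan-g0.lean` (sha16 52323b30a8f1d503).

WHAT IS PROVED (two closed theorems, TRIO axioms):
* §1 `multLeOneAtThetaHol₂_of_curveMultiplicityLeOne : curveMultiplicityLeOne → ‹G1 body VERBATIM›` — the global stub G1
  `F0P5CurveThetaLettersPaydown.MultLeOneAtThetaHol₂` of ★ `Cruxes/HLiu418/Lines/F0_P5_CurveThetaLettersPaydown.lean` :212 («θ-relative right-regular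
  multiplicity `≤ 1` at every `(1,0)`-type `P` with θ-type finite component») is the letter E1₂ `curveMultiplicityLeOne` («multiplicity `≤ 1` at EVERY
  discrete `P`», [Rogawski1990, §11; Thm. 11.5.1 (c)] transported by [Harris1993]) with its extra binders (`𝔣, e₁, λ, a, χ, W, σ, j`, the Hodge type and
  the finite component) IDLE: a one-line restriction.  The conclusion is G1's `def` body token-for-token (a sibling `Lines` module is consumed BY TYPE, not by
  import, as in `F0_AlbCm` :34), so `stub_glob_multLeOneAtThetaHol := multLeOneAtThetaHol₂_of_curveMultiplicityLeOne ‹letter›` elaborates by `δ`.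
* §2 `curveThetaCohFinComponentUnique_hol_of_multLeOneAtThetaHol₂ : ‹G1 body› → curveThetaCohFinComponentUnique_hol` — the Theorems-side (importable) twin
  of the Paydown certificate `paydownCertificate₇₃` (:813, same four ★ bricks: `E1pRealise.archCoefficient_shape` ∕ `holValued_shape`,
  `E2LevelFinite.admissibleOfHolValued₂_holds`, `E1pOfE1.eq_of_discIdentity_of_holRealised`, compactness from one definite place).
* COROLLARY (not restated — gate `dedup.landed`): `§2 (§1 h) : curveThetaCohFinComponentUnique_hol` for `h : curveMultiplicityLeOne` is #73 from the ONE
  letter THROUGH THE PAYDOWN GLUE; as a statement it is ALREADY ★ `Theorems/HLiu418E1Theta.lean`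
  `E1Theta.curveThetaCohFinComponentUnique_hol_of_curveMultiplicityLeOne` (road E1₂ ⇒ E1′hol₂ (★ `E1pOfE1`) ⇒ E1θhol₂ by restriction) — cite that name.

HONEST SCOPE (evidence for LD1-plan's HONESTY FLAG 2026-09-02T04:55:22Z; ruling (ii) prep).  #73 ⇐ the ONE letter `curveMultiplicityLeOne` — the very
letter socket 27458 carried for `stub_S1_facts` in ED. 4R–8 and that ED. 9 SUPERSEDED by the weaker printed row #73 — through glue that is already ★ and
sorry-free.  This file BOOKS NOTHING: no registered stub consumes it, no printed citation is discharged, `curveMultiplicityLeOne` is NOT proved here (it is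
[Rogawski1990, Thm. 11.5.1 (c)] + [LabesseLanglands1979] on the packets `ρ(θ)` + the inner transfer [Harris1993], none of which is typed).  It shows that any
road paying #73 through a hypothesis at least as strong as `curveMultiplicityLeOne` (e.g. the θ-road's organ (R) wired through ★ `F0LD2ThetaRealisationOfLetters`
p849272, whose `hM1` IS this letter) lowers no debt below row III-19.  HC_CM is proved only modulo the 7 printed citations (2 remaining: hLiu418 =
stmt-HodgeConjecture-24832, h413 = stmt-HodgeConjecture-24833) until rung 0 closes.

## References
* [Liu2021] Y. Liu, *Fourier–Jacobi cycles and arithmetic relative trace formula*, Camb. J. Math. 9 (2021) = arXiv:2102.11518: App. D, proof of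
  Prop. D.4 (1) (p. 130 L47 – p. 131 L34: «`m_disc(π) = m_disc(θ(π))`», [Har93]; Matsushima, Lem. D.2).
* [Rogawski1990] J. Rogawski, *Automorphic representations of unitary groups in three variables*, Ann. of Math. Stud. 123 (1990), §11.1 Prop. 11.1.1,
  Prop. 11.2.1, Thm. 11.5.1 (c).
* [KalethaMinguezShinWhite2014] T. Kaletha, A. Minguez, S. W. Shin, P.-J. White, *Endoscopic classification of representations: inner forms of unitary
  groups*, arXiv:1409.3731, Thm. 1.7.1 (the multiplicity formula for inner forms; the letter's modern source).
-/

set_option autoImplicit false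
set_option linter.dupNamespace false

noncomputable section

open NumberField NumberField.InfinitePlace MeasureTheory IsDedekindDomain
open scoped Matrix ComplexOrder
open Literature.NumberTheory.Automorphic Literature.NumberTheory.Automorphic.UnitaryGroup
open Literature.NumberTheory.Automorphic.UnitaryCurveForms
open Literature.NumberTheory.Automorphic.Liu2021 Literature.NumberTheory.Automorphic.Liu2021.Def411WeilCarriers
open Literature.NumberTheory.Automorphic.Liu2021.Def411WeilCarriersDoubling
open Literature.NumberTheory.GaloisRepresentations Literature.NumberTheory.Automorphic.IdeleClassGroup
open Literature.NumberTheory.GelbartRogawski1991 Literature.NumberTheory.GelbartRogawski1991.UnitaryDualPair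
open Literature.NumberTheory.GelbartRogawski1991.UnitaryDualPair.WeilCoinv
open Literature.RepresentationTheory.Liu2021 Literature.RepresentationTheory.HarrisKudlaSweet1996
open Literature.NumberTheory.Rogawski1990

namespace Summit.HodgeConjecture.HodgeConjecture.Cruxes.HLiu418.F0LD1MultLeOneAtThetaHolOfLetter

/-! ## §1 G1 is a restriction of the letter E1₂ `curveMultiplicityLeOne` -/

/-- **G1 ⇐ E1₂ by restriction.**  The conclusion is the body of the Paydown's global stub statement `F0P5CurveThetaLettersPaydown.MultLeOneAtThetaHol₂`
VERBATIM («a discrete `P` of Hodge type `(1,0)` at `ι` whose finite component is a θ-type `σ ↪ ω(λ, ε_a, χ)_f` occurs in `L²` with right-regular multiplicity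
`≤ 1`»); the hypothesis E1₂ `curveMultiplicityLeOne` asserts multiplicity `≤ 1` for EVERY discrete `P` of `U(H)`, so the ω-side data, the cone frame, the
Hodge type and the finite component are simply not used.  [cite: Liu2021, App. D, proof of Prop. D.4 (1) (p. 130–131)] [cite: Rogawski1990, Thm. 11.5.1 (c)]
[cite: KalethaMinguezShinWhite2014, Thm. 1.7.1] -/
theorem multLeOneAtThetaHol₂_of_curveMultiplicityLeOne (h : curveMultiplicityLeOne) :
      ∀ (L : Type) [Field L] [NumberField L] [IsCMField L] (ι : L →+* ℂ) (H : Matrix (Fin 2) (Fin 2) L)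
        (dV : Fin 2 → L) (hdV : ∀ i, IsCMField.complexConj L (dV i) = dV i) (hdV0 : ∀ i, dV i ≠ 0)
        (t : L) (ht : t ≠ 0) (g : GL (Fin 2) L)
        (hg : formCongr ((IsCMField.complexConj L : L ≃ₐ[↥(maximalRealSubfield L)] L) : L →+* L) g (t • H) = Matrix.diagonal dV),
        (∃ T : GL (Fin 2) ℂ, formCongr (starRingEnd ℂ) T ((Matrix.diagonal dV).map ι) = Matrix.diagonal ![(1 : ℂ), -1]) →
        (∀ τ' : L →+* ℂ, InfinitePlace.mk τ' ≠ InfinitePlace.mk ι → ((Matrix.diagonal dV).map τ').PosDef) →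
        4 ≤ Module.finrank ℚ L →
        ∀ (𝔣 : ConeFrame L H (cmPlace L ι))
          (μ : Measure (adelicGroupData (↥(maximalRealSubfield L)) L (IsCMField.complexConj L) 2 H).automorphicQuotient)
          [(adelicGroupData (↥(maximalRealSubfield L)) L (IsCMField.complexConj L) 2 H).IsAutomorphicMeasure μ]
          {n' : ℕ} (e₁ : Fin 2 × Fin 1 ≃ Fin n')
          (lam : Literature.NumberTheory.Automorphic.IdeleClassGroup L →ₜ* Circle) (hlam : IsConjugateSymplectic L lam), HasWeight L lam 1 →
        ∀ (a : (↥(maximalRealSubfield L))ˣ) (χ : Chi (↥(maximalRealSubfield L)) L (IsCMField.complexConj L))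
          (W : Type) [AddCommGroup W] [Module ℂ W]
          (σ : Representation ℂ (finAdelic (↥(maximalRealSubfield L)) L (IsCMField.complexConj L) 2 H) W),
          σ.IsIrreducible → σ.IsSmooth →
        ∀ j : σ.IntertwiningMap
            ((rhoVAtLine (↥(maximalRealSubfield L)) L (IsCMField.complexConj L) 2 e₁ (Matrix.diagonal dV)
                (complexConj_imagUnit L) (imagUnit_ne_zero L) (imagUnit_mul_self L) (realDiagonal_isSymm L dV hdV)
                (isUnit_det_realDiagonal L dV hdV hdV0) (realDiagonal_map L dV hdV).symm
                (fun a => isCompatible_chiSplittingLine L e₁ dV hdV hdV0 (toHeckeCharacter L lam)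
                  (isUnitary_toHeckeCharacter L lam) ((isOscillatorChar_toHeckeCharacter_iff lam).mpr hlam)
                  (TW (↥(maximalRealSubfield L)) a) (isSymm_TW (↥(maximalRealSubfield L)) a)
                  (isUnit_det_TW (↥(maximalRealSubfield L)) a) (JW (↥(maximalRealSubfield L)) L a)
                  (JW_eq (↥(maximalRealSubfield L)) L a)) a χ).comp
              (finAdelicCongr (↥(maximalRealSubfield L)) L (IsCMField.complexConj L) g ht hg).symm.toMonoidHom),
          Function.Injective j →
        ∀ P : DiscreteAutomorphicRep (adelicGroupData (↥(maximalRealSubfield L)) L (IsCMField.complexConj L) 2 H) μ,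
          P.IsHolCotangentAt₂ (IsCMField.complexConj_ne_one L) (UnitaryGroup.complexConj_smul_infinitePlace L) (cmPlace L ι) 𝔣 →
          P.HasFinComponent σ →
          ((adelicGroupData (↥(maximalRealSubfield L)) L (IsCMField.complexConj L) 2 H).rightRegular μ).multiplicity P.space.toContRep ≤ 1 := by
  intro L _ _ _ ι H dV hdV hdV0 t ht g hg hsig hdef h4 𝔣 μ _ n' e₁ lam hlam _ a χ W _ _ σ _ _ j _ P _ _
  exact h L ι H dV hdV hdV0 t ht g hg hsig hdef h4 μ P

/-! ## §2 The Theorems-side twin of the Paydown certificate `PaydownCertificate₇₃`: G1 ⟹ #73 -/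

/-- **#73 ⇐ G1** (the Paydown certificate `paydownCertificate₇₃`, importable copy; hypothesis = G1's body VERBATIM).  Given two `(1,0)`-type discrete `P`, `P′`
with the θ-type finite component `σ`: the quotient `[U(H)]` is compact (one definite place `τ ≠ ι` exists since `[L:ℚ] ≥ 4`, ★ `exists_infinitePlace_ne`;
anisotropy ★ `S1BettiSliceExclusion.anisotropic_of_formCongr_posDef`; ★ `compactSpace_adelicGroupData_automorphicQuotient`); ★ `E1pRealise.archCoefficient_shape`
gives the archimedean matrix-coefficient datum `m`, ★ `E1pRealise.holValued_shape` realises `σ` on holomorphic cotangent forms inside `P` and inside `P′`,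
★ `E2LevelFinite.admissibleOfHolValued₂_holds` makes `σ` admissible, and ★ `E1pOfE1.eq_of_discIdentity_of_holRealised` concludes `P = P′` from the
multiplicity bound AT `P` — which is exactly what G1 supplies at `(P, σ, j)`.  [cite: Liu2021, App. D, proof of Prop. D.4 (1) (p. 130–131); Lem. D.2]
[cite: BorelWallach2000, VII 3.2] [cite: Dixmier1977, §5.4] -/
theorem curveThetaCohFinComponentUnique_hol_of_multLeOneAtThetaHol₂
    (hm :
      ∀ (L : Type) [Field L] [NumberField L] [IsCMField L] (ι : L →+* ℂ) (H : Matrix (Fin 2) (Fin 2) L)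
        (dV : Fin 2 → L) (hdV : ∀ i, IsCMField.complexConj L (dV i) = dV i) (hdV0 : ∀ i, dV i ≠ 0)
        (t : L) (ht : t ≠ 0) (g : GL (Fin 2) L)
        (hg : formCongr ((IsCMField.complexConj L : L ≃ₐ[↥(maximalRealSubfield L)] L) : L →+* L) g (t • H) = Matrix.diagonal dV),
        (∃ T : GL (Fin 2) ℂ, formCongr (starRingEnd ℂ) T ((Matrix.diagonal dV).map ι) = Matrix.diagonal ![(1 : ℂ), -1]) →
        (∀ τ' : L →+* ℂ, InfinitePlace.mk τ' ≠ InfinitePlace.mk ι → ((Matrix.diagonal dV).map τ').PosDef) →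
        4 ≤ Module.finrank ℚ L →
        ∀ (𝔣 : ConeFrame L H (cmPlace L ι))
          (μ : Measure (adelicGroupData (↥(maximalRealSubfield L)) L (IsCMField.complexConj L) 2 H).automorphicQuotient)
          [(adelicGroupData (↥(maximalRealSubfield L)) L (IsCMField.complexConj L) 2 H).IsAutomorphicMeasure μ]
          {n' : ℕ} (e₁ : Fin 2 × Fin 1 ≃ Fin n')
          (lam : Literature.NumberTheory.Automorphic.IdeleClassGroup L →ₜ* Circle) (hlam : IsConjugateSymplectic L lam), HasWeight L lam 1 →
        ∀ (a : (↥(maximalRealSubfield L))ˣ) (χ : Chi (↥(maximalRealSubfield L)) L (IsCMField.complexConj L))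
          (W : Type) [AddCommGroup W] [Module ℂ W]
          (σ : Representation ℂ (finAdelic (↥(maximalRealSubfield L)) L (IsCMField.complexConj L) 2 H) W),
          σ.IsIrreducible → σ.IsSmooth →
        ∀ j : σ.IntertwiningMap
            ((rhoVAtLine (↥(maximalRealSubfield L)) L (IsCMField.complexConj L) 2 e₁ (Matrix.diagonal dV)
                (complexConj_imagUnit L) (imagUnit_ne_zero L) (imagUnit_mul_self L) (realDiagonal_isSymm L dV hdV)
                (isUnit_det_realDiagonal L dV hdV hdV0) (realDiagonal_map L dV hdV).symm
                (fun a => isCompatible_chiSplittingLine L e₁ dV hdV hdV0 (toHeckeCharacter L lam)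
                  (isUnitary_toHeckeCharacter L lam) ((isOscillatorChar_toHeckeCharacter_iff lam).mpr hlam)
                  (TW (↥(maximalRealSubfield L)) a) (isSymm_TW (↥(maximalRealSubfield L)) a)
                  (isUnit_det_TW (↥(maximalRealSubfield L)) a) (JW (↥(maximalRealSubfield L)) L a)
                  (JW_eq (↥(maximalRealSubfield L)) L a)) a χ).comp
              (finAdelicCongr (↥(maximalRealSubfield L)) L (IsCMField.complexConj L) g ht hg).symm.toMonoidHom),
          Function.Injective j →
        ∀ P : DiscreteAutomorphicRep (adelicGroupData (↥(maximalRealSubfield L)) L (IsCMField.complexConj L) 2 H) μ,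
          P.IsHolCotangentAt₂ (IsCMField.complexConj_ne_one L) (UnitaryGroup.complexConj_smul_infinitePlace L) (cmPlace L ι) 𝔣 →
          P.HasFinComponent σ →
          ((adelicGroupData (↥(maximalRealSubfield L)) L (IsCMField.complexConj L) 2 H).rightRegular μ).multiplicity P.space.toContRep ≤ 1)
    : curveThetaCohFinComponentUnique_hol := by
  intro L _ _ _ ι H dV hdV hdV0 t ht g hg hsig hdef h4 𝔣 μ _ n' e₁ lam hlam hw a χ W _ _ σ hirr hsm j hj P P' hP hP' hPσ hP'σ
  obtain ⟨τ, hτ⟩ := UnitaryGroup.exists_infinitePlace_ne L h4 ι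
  have hanis := S1BettiSliceExclusion.anisotropic_of_formCongr_posDef L H t g dV hg τ (hdef τ hτ)
  haveI := UnitaryGroup.compactSpace_adelicGroupData_automorphicQuotient L 2 H hanis
  obtain ⟨m, hm'⟩ := E1pRealise.archCoefficient_shape L ι H dV hdV hdV0 t ht g hg hsig hdef h4 𝔣 μ
  obtain ⟨ψ, hE, hV, hne⟩ := E1pRealise.holValued_shape L ι H dV hdV hdV0 t ht g hg hsig hdef h4 𝔣 μ W σ hirr hsm P hP hPσ
  obtain ⟨ψ', hE', hV', hne'⟩ := E1pRealise.holValued_shape L ι H dV hdV hdV0 t ht g hg hsig hdef h4 𝔣 μ W σ hirr hsm P' hP' hP'σ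
  have hadm : σ.IsAdmissible :=
    E2LevelFinite.admissibleOfHolValued₂_holds L ι H dV hdV hdV0 t ht g hg hsig hdef h4 𝔣 μ P W σ hirr hsm ψ hE hV hne
  exact E1pOfE1.eq_of_discIdentity_of_holRealised (hm L ι H dV hdV hdV0 t ht g hg hsig hdef h4 𝔣 μ e₁ lam hlam hw a χ W σ hirr hsm j hj P hP hPσ)
    m hm' σ hirr hadm ψ hE hV hne ψ' hE' hV' hne'

end Summit.HodgeConjecture.HodgeConjecture.Cruxes.HLiu418.F0LD1MultLeOneAtThetaHolOfLetter

end
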